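import Literature.MathematicalPhysics.StatisticalMechanics.LennardJonesClusters
import Mathlib.MeasureTheory.Integral.Bochner.Basic
import Mathlib.Analysis.Normed.Lp.MeasurableSpace
import Mathlib.MeasureTheory.Measure.Count
import Mathlib.MeasureTheory.Measure.Dirac
import HarnessLib

/-!
# The energy of the root of a rooted configuration (Palm-side energy observable)

Topic: `Literature/MathematicalPhysics/StatisticalMechanics`. Definition request `defn-rootEnergy`
(route `AtomisticToContinuum/Crystallization/PalmUnimodularRigidity`, which so far inlines the
term `(∫ y, lennardJones ‖y‖ ∂μ) / 2`).

## Content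

A *rooted configuration* of `ℝᵈ` is encoded, as in the requesting route, by a measure
`μ : Measure (EuclideanSpace ℝ (Fin d))` — typically the counting measure `count|S` of a locally
finite set `S ∋ 0`, the configuration seen from one of its points (the *root*, sitting at the
origin). For a pair potential `V : ℝ → ℝ`,

* `rootEnergy V μ = ½ ∫ V(‖y‖) dμ(y)` — half the interaction of the root with the configuration;
  for `μ = count|S` this is `½ ∑_{y ∈ S} V(‖y‖)`, i.e. `½ (V(0) + ∑_{y ∈ S ∖ {0}} V(‖y‖))`, and
  for the Lennard-Jones potential of `Crystallization.lean` the root's own term vanishes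
  (`lennardJones 0 = 0`), so that `rootEnergy lennardJones (count|S) = ½ ∑_{0 ≠ y ∈ S} V_LJ(‖y‖)`
  is exactly the observable `γ ↦ ½ ∑_{0 ≠ x ∈ γ} φ(x)` whose expectation under the Palm measure
  `P⁰` of a stationary point process `P` is the mean energy per unit volume,
  `H(P) = ½ ∫ ∑_{0 ≠ x ∈ γ} φ(x) P⁰(dγ)` (Dereudre 2019, §2.6, proof of Prop. 12, crediting
  Georgii 1994, Thm 1). Minimising `P ↦ E_P[rootEnergy V]` over point-stationary (Palm) laws is
  the Palm-side form of Radin's "ground states as energy-minimising invariant measures"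
  (Radin 1991) used by the requesting route.

API: the unfolding lemma `rootEnergy_def`; `rootEnergy` of the zero measure; the counting
measure of a finite set as a sum of Dirac masses (`count_restrict_coe_finset`) and the resulting
finite-sum formulas `integral_count_restrict_coe_finset`, `rootEnergy_count_restrict_coe_finset`;
and the link with the finite-`N` objects of `Crystallization.lean` / `LennardJonesClusters.lean`:
rooting a configuration `x : Fin N → ℝᵈ` of distinct points at particle `i` (the counting measure
of `{x_k - x_i | k}`) gives `rootEnergy V = ½ (V 0 + 𝓔ⁱ(x))` (`rootEnergy_rooted_eq`), hence,
summing over the `N` roots, `∑ᵢ rootEnergy = 𝓔_N(x) + N·V(0)/2` (`sum_rootEnergy_rooted_eq`) — for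
Lennard-Jones `∑ᵢ rootEnergy = 𝓔_N(x)`, i.e. the energy per particle `𝓔_N(x)/N` is the EXPECTED
root energy under the uniformly rooted empirical law (`sum_rootEnergy_rooted_lennardJones`,
`interactionEnergy_div_eq_avg_rootEnergy_lennardJones`), the exact identity `E(N)/N = E_{P_N}[h]`
behind Benjamini–Schramm limits of ground states.

## Sources

* D. Dereudre, *Introduction to the theory of Gibbs point processes*, in: Stochastic Geometry,
  Lecture Notes in Math. 2237, Springer (2019), 181–229, arXiv:1701.08105 — §2.6 (variational
  principle), proof of Proposition 12: `H(P) = ½ ∫ ∑_{0 ≠ x ∈ γ} φ(x) P⁰(dγ)` with `P⁰` the Palm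
  measure of `P` ("proved in [Georgii94], Theorem 1").
* H.-O. Georgii, *Large deviations and the equivalence of ensembles for Gibbsian particle
  systems with superstable interaction*, PTRF 99 (1994) 171–195, Thm 1 (as credited by Dereudre).
* C. Radin, *Global order from local sources*, Bull. AMS 24 (1991) 335–364 (ground states as
  minimising invariant measures; motivation only).

## Design choices and wording risks

* **Measures, not point sets.** The argument is a `Measure`, exactly as in the requesting route
  (configurations are `count|S`); multiplicities and non-atomic `μ` are allowed by the type and
  mean what the formula says.
* **Bochner integral, junk value.** `∫` is Mathlib's Bochner integral: if `y ↦ V ‖y‖` is not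
  `μ`-integrable the integral is `0` (so `rootEnergy V μ = 0`). For hard-core configurations in
  `ℝ³` and the Lennard-Jones potential the sum `∑ V_LJ(‖y‖)` converges absolutely (`r⁻⁶` tail), so
  no junk value enters the route's statements; this file does not prove that.
* **The root's own term.** `rootEnergy` integrates over ALL of `μ`, including the atom at the
  root; the printed observable omits `x = 0`. The two agree whenever `V 0 = 0` (Lennard-Jones:
  `lennardJones_zero`), and in general differ by `V(0)·μ{0}/2` (`rootEnergy_rooted_eq` displays the
  `V 0` term explicitly). This follows the requester's inlined term verbatim.
* Nothing about Palm measures, point-stationarity or the variational problem is defined here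
  (separate request `IsPointStationaryLaw`, topic `Probability/Process`).
-/

noncomputable section

open MeasureTheory

namespace Literature.MathematicalPhysics.StatisticalMechanics

variable (V : ℝ → ℝ) {d : ℕ}

/-- **Energy of the root** of a rooted configuration `μ` of `ℝᵈ` (a measure, typically the
counting measure `count|S` of a point configuration `S ∋ 0` seen from its root at the origin)
for the pair potential `V`: `rootEnergy V μ = ½ ∫ V(‖y‖) dμ(y)` — half the interaction energy of
the root with the configuration (each pair interaction is shared by its two ends). For `V` with
`V 0 = 0` (e.g. `lennardJones`) and `μ = count|γ` this is the observable `½ ∑_{0 ≠ x ∈ γ} φ(x)`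
whose Palm expectation is the mean energy of a stationary point process,
`H(P) = ½ ∫ ∑_{0 ≠ x ∈ γ} φ(x) P⁰(dγ)` (Dereudre 2019, §2.6, proof of Prop. 12; Georgii 1994,
Thm 1). Bochner integral: junk value `0` when `y ↦ V ‖y‖` is not `μ`-integrable.
[cite: Dereudre2019, §2.6 proof of Prop. 12] -/
def rootEnergy (μ : Measure (EuclideanSpace ℝ (Fin d))) : ℝ :=
  (∫ y, V ‖y‖ ∂μ) / 2

/-- Unfolding lemma: `rootEnergy V μ = (∫ V ‖y‖ dμ) / 2`. [folklore] -/
theorem rootEnergy_def (μ : Measure (EuclideanSpace ℝ (Fin d))) :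
    rootEnergy V μ = (∫ y, V ‖y‖ ∂μ) / 2 :=
  rfl

/-- The empty configuration (zero measure) has root energy `0`. [folklore] -/
@[simp]
theorem rootEnergy_zero_measure :
    rootEnergy V (0 : Measure (EuclideanSpace ℝ (Fin d))) = 0 := by
  simp [rootEnergy]

/-- A single atom at the root: `rootEnergy V δ_y = V(‖y‖)/2`; in particular `δ₀ ↦ V(0)/2`
(`= 0` for Lennard-Jones). [folklore] -/
@[simp]
theorem rootEnergy_dirac (y : EuclideanSpace ℝ (Fin d)) :
    rootEnergy V (Measure.dirac y) = V ‖y‖ / 2 := by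
  rw [rootEnergy, integral_dirac]

/-! ## Finite configurations: counting measures of finite sets -/

section Finite

variable {E : Type*} [MeasurableSpace E] [MeasurableSingletonClass E]

/-- The counting measure restricted to a finite set is the sum of the Dirac masses at its
points: `count|S = ∑_{y ∈ S} δ_y`. [folklore] -/
theorem count_restrict_coe_finset (S : Finset E) :
    Measure.count.restrict (↑S : Set E) = ∑ y ∈ S, Measure.dirac y := by
  classical
  induction S using Finset.induction_on with
  | empty => simp
  | insert a S ha ih =>
    rw [Finset.coe_insert, Set.insert_eq,
      Measure.restrict_union (Set.disjoint_singleton_left.2 (by exact_mod_cast ha))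
        S.measurableSet,
      ih, Measure.restrict_singleton, Measure.count_singleton, one_smul, Finset.sum_insert ha]

/-- Integration against the counting measure of a finite set is a finite sum (no integrability
or measurability hypothesis: every function is integrable against a Dirac mass when singletons
are measurable). [folklore] -/
theorem integral_count_restrict_coe_finset (S : Finset E) (f : E → ℝ) :
    ∫ y, f y ∂(Measure.count.restrict (↑S : Set E)) = ∑ y ∈ S, f y := by
  rw [count_restrict_coe_finset, integral_finsetSum_measure fun i _ => integrable_dirac (by simp)]
  simp

end Finite

/-- Root energy of a finite rooted configuration `count|S`, `S` a finite set:
`rootEnergy V (count|S) = ½ ∑_{y ∈ S} V(‖y‖)`. [folklore] -/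
theorem rootEnergy_count_restrict_coe_finset (S : Finset (EuclideanSpace ℝ (Fin d))) :
    rootEnergy V (Measure.count.restrict (↑S : Set (EuclideanSpace ℝ (Fin d)))) =
      (∑ y ∈ S, V ‖y‖) / 2 := by
  rw [rootEnergy, integral_count_restrict_coe_finset]

/-! ## Rooting a finite configuration at one of its particles -/

section Rooted

variable {N : ℕ}

/-- The configuration `x` of `N` distinct points seen from particle `i` is the finite set
`{x_k - x_i | k}`, the image of `Finset.univ`. [folklore] -/
theorem range_sub_eq_coe_image (x : Fin N → EuclideanSpace ℝ (Fin d)) (i : Fin N) :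
    Set.range (fun k => x k - x i) =
      ↑(Finset.univ.image fun k => x k - x i : Finset (EuclideanSpace ℝ (Fin d))) := by
  rw [Finset.coe_image, Finset.coe_univ, Set.image_univ]

/-- **Root energy of a finite configuration rooted at particle `i`.** For `N` distinct points
`x` and the rooted configuration `count|{x_k - x_i | k}` (particle `i` moved to the origin),
`rootEnergy V = ½ (V(0) + 𝓔ⁱ(x))`, where `𝓔ⁱ(x) = ∑_{k ≠ i} V(|x_i - x_k|)` is the site energy
(`siteEnergy`) and `V(0)` is the root's own (junk) term. [folklore] -/
theorem rootEnergy_rooted_eq {x : Fin N → EuclideanSpace ℝ (Fin d)} (hx : Function.Injective x)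
    (i : Fin N) :
    rootEnergy V (Measure.count.restrict (Set.range fun k => x k - x i)) =
      (V 0 + siteEnergy V x i) / 2 := by
  have hinj : Function.Injective fun k => x k - x i := fun k l h => hx (sub_left_inj.1 h)
  rw [range_sub_eq_coe_image, rootEnergy_count_restrict_coe_finset,
    Finset.sum_image fun k _ l _ h => hinj h, ← Finset.add_sum_erase _ _ (Finset.mem_univ i),
    sub_self, norm_zero, siteEnergy]
  congr 3 with k
  rw [dist_comm, dist_eq_norm]

/-- **Summing the root energy over all roots gives the total energy** (up to the root terms):
`∑ᵢ rootEnergy V (count|{x_k - x_i | k}) = 𝓔_N(x) + N · V(0)/2`, by double counting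
`2 𝓔_N = ∑ᵢ 𝓔ⁱ` (`two_mul_interactionEnergy`). [folklore] -/
theorem sum_rootEnergy_rooted_eq {x : Fin N → EuclideanSpace ℝ (Fin d)}
    (hx : Function.Injective x) :
    ∑ i, rootEnergy V (Measure.count.restrict (Set.range fun k => x k - x i)) =
      interactionEnergy V x + N * (V 0 / 2) := by
  simp_rw [rootEnergy_rooted_eq V hx, add_div, Finset.sum_add_distrib, Finset.sum_const,
    Finset.card_univ, Fintype.card_fin, nsmul_eq_mul, ← Finset.sum_div,
    ← two_mul_interactionEnergy]
  ring

/-- Lennard-Jones: the root's own term vanishes (`lennardJones 0 = 0`), so the root energy of a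
configuration of distinct points rooted at particle `i` is exactly half its site energy,
`½ 𝓔ⁱ(x)`. [folklore] -/
theorem rootEnergy_rooted_lennardJones {x : Fin N → EuclideanSpace ℝ (Fin d)}
    (hx : Function.Injective x) (i : Fin N) :
    rootEnergy lennardJones (Measure.count.restrict (Set.range fun k => x k - x i)) =
      siteEnergy lennardJones x i / 2 := by
  rw [rootEnergy_rooted_eq lennardJones hx, lennardJones_zero, zero_add]

/-- Lennard-Jones: `∑ᵢ rootEnergy (count|{x_k - x_i | k}) = 𝓔_N(x)` for distinct points — the
total energy is the sum over roots of the root energies. [folklore] -/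
theorem sum_rootEnergy_rooted_lennardJones {x : Fin N → EuclideanSpace ℝ (Fin d)}
    (hx : Function.Injective x) :
    ∑ i, rootEnergy lennardJones (Measure.count.restrict (Set.range fun k => x k - x i)) =
      interactionEnergy lennardJones x := by
  rw [sum_rootEnergy_rooted_eq lennardJones hx, lennardJones_zero, zero_div, mul_zero, add_zero]

/-- **`𝓔_N(x)/N` is the mean root energy under uniform rooting** (Lennard-Jones, `N` distinct
points, `N ≠ 0`): `𝓔_N(x)/N = (1/N) ∑ᵢ rootEnergy (count|{x_k - x_i | k})`; at a ground state the
left side is `E(N)/N`. This is the exact finite-`N` identity `E(N)/N = E_{P_N}[h]` for the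
uniformly rooted empirical law `P_N = (1/N) ∑ᵢ δ_{count|{x_k - x_i | k}}`. [folklore] -/
theorem interactionEnergy_div_eq_avg_rootEnergy_lennardJones
    {x : Fin N → EuclideanSpace ℝ (Fin d)} (hx : Function.Injective x) :
    interactionEnergy lennardJones x / N =
      (N : ℝ)⁻¹ *
        ∑ i, rootEnergy lennardJones (Measure.count.restrict (Set.range fun k => x k - x i)) := by
  rw [sum_rootEnergy_rooted_lennardJones hx, div_eq_inv_mul]

end Rooted

end Literature.MathematicalPhysics.StatisticalMechanics

end
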